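import Mathlib
import Summits.NavierStokesRegularity.NavierStokesRegularity.Theorems.FilamentSkeletonRssSkeletonJ1RLiaDerivKernelMismatch
import Summits.NavierStokesRegularity.NavierStokesRegularity.Theorems.FilamentSkeletonRssSkeletonJ1RLiaPartnerWindow

/-!
# Crux `SkeletonJ1R` (stmt-NavierStokesRegularity-23610) · line `streamline_kantorovich_R` · toward stub F2-d (`LiaDefectDerivBL`, v7), brick P1′:
# THE INTEGRATED PARTNER MISMATCH OF THE DERIVATIVE KERNEL WITH POLYNOMIAL ENVELOPES — `(7‖P‖/a) ×` the P1 bound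

Hand `leafhand-ns-filamentskeletonrs-1` (gen 0), `--supports stmt-NavierStokesRegularity-23610 --as helper`.  MODEL rung, NEGATIVE side of the ladder:
kernel calculus for a HYPOTHETICAL filament-type blow-up skeleton; nothing here is a claim about Navier–Stokes regularity; the stub and the crux stay OPEN.

The derivative-kernel analogue of `…SkeletonJ1RLiaPartnerWindow` (`SkeletonJ1RMismatchTools.norm_integral_kernelCross_sub_le_of_envelopes`, P1 of the
F2-B chain).  With `G(w,a,v) = (−3⟪w,v⟫K₅(w))•a×w + K₃(w)•a×v` (the `y`-derivative of the regularised Biot–Savart integrand in direction `v`), a point `y`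
at perpendicular distance `a > 0` from the line `L` with foot parameter `s` (`a² + (σ−s)² ≤ ‖y − L σ‖²`), a curve `x` with displacement envelopes
`‖x σ − L σ‖ ≤ d₂σ² + d₃|σ|³`, `≤ θ|σ|`, `≤ ‖y − Lσ‖/5` and tilt envelopes `‖x′σ − t‖ ≤ t₁|σ| + t₂σ²`, `≤ θ`, and any `Lk ≥ 2|s|`, `Lk > 0`:
`‖∫ [G(y − xσ, x′σ, P) − G(y − Lσ, t, P)] dσ‖ ≤ (7‖P‖/a)·(2Lk·A₀ + πA₁/a + 416πθ/Lk)`, `A₀, A₁` as in P1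
(`norm_integral_derivKernel_sub_le_of_envelopes`).  The pointwise brick is the landed `norm_derivKernel_mismatch_le` (`‖P‖(8θ/r³ + 157δ/r⁴)`): one
more power of `1/r ≤ 1/a` than P1, which is paid ONCE by the prefactor `1/a` (`inner_zone_deriv_majorant`, `outer_zone_deriv_majorant`, reducing to the
landed zone algebra `inner_zone_majorant` / `outer_zone_majorant` with `8 ≤ 7·2`, `157 ≤ 7·25`); the zone integrals are then those of P1 verbatim
(Cauchy majorant `∫(a²+u²)⁻¹ = π/a` and interval lengths only — RATE B).
-/

set_option linter.dupNamespace false -- `NavierStokesRegularity.NavierStokesRegularity` path/namespace repetition is the tree convention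

noncomputable section

namespace Summit.NavierStokesRegularity.NavierStokesRegularity.Theorems.SkeletonJ1RFrame

open Set Function Filter Real Topology MeasureTheory
open Literature.Analysis.FluidPDE
open Summit.NavierStokesRegularity.NavierStokesRegularity.Theorems.SkeletonJ1RMismatchTools
  (inner_zone_majorant outer_zone_majorant integral_inv_sq_add_sq integrable_inv_sq_add_sq)
open scoped InnerProductSpace BigOperators

/-! ## §1 Zone algebra: one more power of `1/r`, paid by `1/a` -/

/-- Inner-zone algebra for the derivative kernel: `8(t₁|σ|+t₂σ²)/r³ + 157(d₂σ²+d₃|σ|³)/r⁴ ≤ (7/a)·(A₀ + A₁ψ⁻¹)`, `ψ = a² + (σ−s)² ≤ r²`. [folklore] -/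
theorem inner_zone_deriv_majorant {a s σ r d₂ d₃ t₁ t₂ : ℝ} (ha : 0 < a) (hr : 0 < r) (hψr : a ^ 2 + (σ - s) ^ 2 ≤ r ^ 2)
    (hd₂ : 0 ≤ d₂) (hd₃ : 0 ≤ d₃) (ht₁ : 0 ≤ t₁) (ht₂ : 0 ≤ t₂) :
    8 * (t₁ * |σ| + t₂ * σ ^ 2) / r ^ 3 + 157 * (d₂ * σ ^ 2 + d₃ * |σ| ^ 3) / r ^ 4 ≤
      7 / a * ((50 * d₂ / a + 100 * d₃ + t₁ / a + 4 * t₂) +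
        (50 * d₂ * s ^ 2 / a + 100 * d₃ * |s| ^ 3 / a + 2 * t₁ * |s| + 4 * t₂ * s ^ 2) * (a ^ 2 + (σ - s) ^ 2)⁻¹) := by
  have h := inner_zone_majorant ha hr hψr hd₂ hd₃ ht₁ ht₂
  have har : a ≤ r := by nlinarith [sq_nonneg (σ - s), sq_nonneg (r - a), sq_nonneg (r + a)]
  have ha' : a ≠ 0 := ha.ne'
  have hr' : r ≠ 0 := hr.ne'
  set X : ℝ := d₂ * σ ^ 2 + d₃ * |σ| ^ 3 with hX
  set Y : ℝ := t₁ * |σ| + t₂ * σ ^ 2 with hY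
  have hX0 : 0 ≤ X := by positivity
  have hY0 : 0 ≤ Y := by positivity
  have hr2 : 0 < r ^ 2 := by positivity
  have hr3 : 0 < r ^ 3 := by positivity
  have har2 : a * r ^ 2 ≤ r ^ 3 := by nlinarith [mul_le_mul_of_nonneg_right har hr2.le]
  have har3 : a * r ^ 3 ≤ r ^ 4 := by nlinarith [mul_le_mul_of_nonneg_right har hr3.le]
  have hYr : 0 ≤ Y / r ^ 2 := by positivity
  have hXr : 0 ≤ X / r ^ 3 := by positivity
  calc 8 * Y / r ^ 3 + 157 * X / r ^ 4 ≤ 8 * Y / (a * r ^ 2) + 157 * X / (a * r ^ 3) :=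
        add_le_add (div_le_div_of_nonneg_left (by positivity) (by positivity) har2)
          (div_le_div_of_nonneg_left (by positivity) (by positivity) har3)
    _ = 1 / a * (8 * (Y / r ^ 2) + 157 * (X / r ^ 3)) := by field_simp
    _ ≤ 1 / a * (7 * (25 * X / r ^ 3 + 2 * (Y / r ^ 2))) := by
        refine mul_le_mul_of_nonneg_left ?_ (by positivity)
        have e1 : 25 * X / r ^ 3 = 25 * (X / r ^ 3) := by ring
        rw [e1]; nlinarith
    _ = 7 / a * (25 * X / r ^ 3 + 2 * Y / r ^ 2) := by ring
    _ ≤ _ := mul_le_mul_of_nonneg_left h (by positivity)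

/-- Outer-zone algebra for the derivative kernel: for `|σ| > Lk ≥ 2|s|`, `a ≤ r`, `|σ − s| ≤ r`:
`8θ/r³ + 157θ|σ|/r⁴ ≤ (7/a)·416θ·(Lk² + σ²)⁻¹`. [folklore] -/
theorem outer_zone_deriv_majorant {a s σ Lk θ r : ℝ} (ha : 0 < a) (har : a ≤ r) (hLk : 0 < Lk) (hLs : 2 * |s| ≤ Lk) (hθ : 0 ≤ θ)
    (hσ : Lk < |σ|) (hr : |σ - s| ≤ r) :
    8 * θ / r ^ 3 + 157 * (θ * |σ|) / r ^ 4 ≤ 7 / a * (416 * θ * (Lk ^ 2 + (σ - 0) ^ 2)⁻¹) := by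
  have h := outer_zone_majorant hLk hLs hθ hσ hr
  have hr0 : 0 < r := ha.trans_le har
  have ha' : a ≠ 0 := ha.ne'
  have hr' : r ≠ 0 := hr0.ne'
  have hr2 : 0 < r ^ 2 := by positivity
  have hr3 : 0 < r ^ 3 := by positivity
  have har2 : a * r ^ 2 ≤ r ^ 3 := by nlinarith [mul_le_mul_of_nonneg_right har hr2.le]
  have har3 : a * r ^ 3 ≤ r ^ 4 := by nlinarith [mul_le_mul_of_nonneg_right har hr3.le]
  have hA : 0 ≤ θ / r ^ 2 := by positivity
  have hB : 0 ≤ θ * |σ| / r ^ 3 := by positivity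
  calc 8 * θ / r ^ 3 + 157 * (θ * |σ|) / r ^ 4 ≤ 8 * θ / (a * r ^ 2) + 157 * (θ * |σ|) / (a * r ^ 3) :=
        add_le_add (div_le_div_of_nonneg_left (by positivity) (by positivity) har2)
          (div_le_div_of_nonneg_left (by positivity) (by positivity) har3)
    _ = 1 / a * (8 * (θ / r ^ 2) + 157 * (θ * |σ| / r ^ 3)) := by field_simp
    _ ≤ 1 / a * (7 * (25 * (θ * |σ|) / r ^ 3 + 2 * θ / r ^ 2)) := by
        refine mul_le_mul_of_nonneg_left ?_ (by positivity)
        have e1 : 25 * (θ * |σ|) / r ^ 3 = 25 * (θ * |σ| / r ^ 3) := by ring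
        have e2 : 2 * θ / r ^ 2 = 2 * (θ / r ^ 2) := by ring
        rw [e1, e2]; nlinarith
    _ = 7 / a * (25 * (θ * |σ|) / r ^ 3 + 2 * θ / r ^ 2) := by ring
    _ ≤ _ := mul_le_mul_of_nonneg_left h (by positivity)

/-! ## §2 The integrated derivative-kernel mismatch with polynomial envelopes -/

set_option maxHeartbeats 800000 in
/-- **Integrated DERIVATIVE-kernel mismatch for one partner, polynomial envelopes (RATE B).**  See the module docstring. [folklore] -/
theorem norm_integral_derivKernel_sub_le_of_envelopes {q : ℝ} (hq : 0 < q) {L x : ℝ → EuclideanSpace ℝ (Fin 3)}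
    {y t P : EuclideanSpace ℝ (Fin 3)} {a s d₂ d₃ t₁ t₂ θ Lk : ℝ} (ha : 0 < a) (hd₂ : 0 ≤ d₂) (hd₃ : 0 ≤ d₃) (ht₁ : 0 ≤ t₁)
    (ht₂ : 0 ≤ t₂) (hθ : 0 ≤ θ) (ht : ‖t‖ = 1) (hLk : 0 < Lk) (hLs : 2 * |s| ≤ Lk)
    (hline : ∀ σ, a ^ 2 + (σ - s) ^ 2 ≤ ‖y - L σ‖ ^ 2)
    (hdisp : ∀ σ, ‖x σ - L σ‖ ≤ d₂ * σ ^ 2 + d₃ * |σ| ^ 3) (hdispθ : ∀ σ, ‖x σ - L σ‖ ≤ θ * |σ|)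
    (htilt : ∀ σ, ‖deriv x σ - t‖ ≤ t₁ * |σ| + t₂ * σ ^ 2) (htiltθ : ∀ σ, ‖deriv x σ - t‖ ≤ θ)
    (hsmall : ∀ σ, ‖x σ - L σ‖ ≤ ‖y - L σ‖ / 5)
    (hintA : Integrable fun σ : ℝ => (-3 * ⟪y - x σ, P⟫_ℝ * ((‖y - x σ‖ ^ 2 + q) ^ (5 / 2 : ℝ))⁻¹) • cross (deriv x σ) (y - x σ) +
        ((‖y - x σ‖ ^ 2 + q) ^ (3 / 2 : ℝ))⁻¹ • cross (deriv x σ) P)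
    (hintB : Integrable fun σ : ℝ => (-3 * ⟪y - L σ, P⟫_ℝ * ((‖y - L σ‖ ^ 2 + q) ^ (5 / 2 : ℝ))⁻¹) • cross t (y - L σ) +
        ((‖y - L σ‖ ^ 2 + q) ^ (3 / 2 : ℝ))⁻¹ • cross t P) :
    ‖∫ σ : ℝ, (((-3 * ⟪y - x σ, P⟫_ℝ * ((‖y - x σ‖ ^ 2 + q) ^ (5 / 2 : ℝ))⁻¹) • cross (deriv x σ) (y - x σ) +
          ((‖y - x σ‖ ^ 2 + q) ^ (3 / 2 : ℝ))⁻¹ • cross (deriv x σ) P) -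
        ((-3 * ⟪y - L σ, P⟫_ℝ * ((‖y - L σ‖ ^ 2 + q) ^ (5 / 2 : ℝ))⁻¹) • cross t (y - L σ) +
          ((‖y - L σ‖ ^ 2 + q) ^ (3 / 2 : ℝ))⁻¹ • cross t P))‖ ≤
      7 * ‖P‖ / a * (2 * Lk * (50 * d₂ / a + 100 * d₃ + t₁ / a + 4 * t₂) +
        (50 * d₂ * s ^ 2 / a + 100 * d₃ * |s| ^ 3 / a + 2 * t₁ * |s| + 4 * t₂ * s ^ 2) * (Real.pi / a) +
        416 * θ * (Real.pi / Lk)) := by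
  set A₀ : ℝ := 50 * d₂ / a + 100 * d₃ + t₁ / a + 4 * t₂ with hA₀
  set A₁ : ℝ := 50 * d₂ * s ^ 2 / a + 100 * d₃ * |s| ^ 3 / a + 2 * t₁ * |s| + 4 * t₂ * s ^ 2 with hA₁
  have hA₀0 : 0 ≤ A₀ := by positivity
  have hA₁0 : 0 ≤ A₁ := by positivity
  set c₇ : ℝ := 7 * ‖P‖ / a with hc₇
  have hc₇0 : 0 ≤ c₇ := by positivity
  set F : ℝ → EuclideanSpace ℝ (Fin 3) := fun σ =>
    ((-3 * ⟪y - x σ, P⟫_ℝ * ((‖y - x σ‖ ^ 2 + q) ^ (5 / 2 : ℝ))⁻¹) • cross (deriv x σ) (y - x σ) +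
          ((‖y - x σ‖ ^ 2 + q) ^ (3 / 2 : ℝ))⁻¹ • cross (deriv x σ) P) -
        ((-3 * ⟪y - L σ, P⟫_ℝ * ((‖y - L σ‖ ^ 2 + q) ^ (5 / 2 : ℝ))⁻¹) • cross t (y - L σ) +
          ((‖y - L σ‖ ^ 2 + q) ^ (3 / 2 : ℝ))⁻¹ • cross t P) with hF
  -- the majorants (those of P1, scaled by `c₇` at the end)
  set m₁ : ℝ → ℝ := (Icc (-Lk) Lk).indicator fun σ => A₀ + A₁ * (a ^ 2 + (σ - s) ^ 2)⁻¹ with hm₁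
  set m₂ : ℝ → ℝ := fun σ => 416 * θ * (Lk ^ 2 + (σ - 0) ^ 2)⁻¹ with hm₂
  have hm₁0 : ∀ σ, 0 ≤ m₁ σ := fun σ => by rw [hm₁]; exact Set.indicator_nonneg (fun z _ => by positivity) σ
  have hm₂0 : ∀ σ, 0 ≤ m₂ σ := fun σ => by rw [hm₂]; positivity
  have hψc : Continuous fun σ : ℝ => (a ^ 2 + (σ - s) ^ 2)⁻¹ := by
    have hf : Continuous fun σ : ℝ => a ^ 2 + (σ - s) ^ 2 := by fun_prop
    exact hf.inv₀ fun σ => (by positivity : (0:ℝ) < a ^ 2 + (σ - s) ^ 2).ne'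
  have hI₁ : Integrable m₁ := ((continuous_const.add (continuous_const.mul hψc)).integrableOn_Icc).integrable_indicator measurableSet_Icc
  have hI₂ : Integrable m₂ := (integrable_inv_sq_add_sq hLk 0).const_mul _
  -- pointwise
  have hmaj : ∀ σ, ‖F σ‖ ≤ c₇ * (m₁ σ + m₂ σ) := by
    intro σ
    set r := ‖y - L σ‖ with hr
    have hq' : 0 < a ^ 2 + (σ - s) ^ 2 := by positivity
    have hr2 : a ^ 2 + (σ - s) ^ 2 ≤ r ^ 2 := hline σ
    have hrpos : 0 < r := by
      by_contra h
      have h0 : r = 0 := le_antisymm (not_lt.1 h) (by rw [hr]; exact norm_nonneg _)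
      rw [h0] at hr2; nlinarith [sq_nonneg (σ - s)]
    have har : a ≤ r := by nlinarith [sq_nonneg (σ - s), sq_nonneg (r - a), sq_nonneg (r + a)]
    have hus : |σ - s| ≤ r := by
      have h := Real.sqrt_le_sqrt (show (σ - s) ^ 2 ≤ r ^ 2 by nlinarith)
      rwa [Real.sqrt_sq_eq_abs, Real.sqrt_sq hrpos.le] at h
    have hδr : ‖x σ - L σ‖ ≤ r / 5 := hsmall σ
    by_cases hin : |σ| ≤ Lk
    · -- inner zone
      have hpt := norm_derivKernel_mismatch_le (P := P) hq hrpos (norm_nonneg (x σ - L σ)) hδr ht hr.symm le_rfl (htilt σ)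
      have hmem : σ ∈ Icc (-Lk) Lk := ⟨by linarith [neg_abs_le σ, hin], (le_abs_self σ).trans hin⟩
      have hm₁σ : m₁ σ = A₀ + A₁ * (a ^ 2 + (σ - s) ^ 2)⁻¹ := by rw [hm₁, Set.indicator_of_mem hmem]
      have hD4 : 157 * ‖x σ - L σ‖ / r ^ 4 ≤ 157 * (d₂ * σ ^ 2 + d₃ * |σ| ^ 3) / r ^ 4 := by
        gcongr; exact hdisp σ
      have halg := inner_zone_deriv_majorant (s := s) (σ := σ) ha hrpos hr2 hd₂ hd₃ ht₁ ht₂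
      calc ‖F σ‖ ≤ ‖P‖ * (8 * (t₁ * |σ| + t₂ * σ ^ 2) / r ^ 3 + 157 * ‖x σ - L σ‖ / r ^ 4) := hpt
        _ ≤ ‖P‖ * (8 * (t₁ * |σ| + t₂ * σ ^ 2) / r ^ 3 + 157 * (d₂ * σ ^ 2 + d₃ * |σ| ^ 3) / r ^ 4) := by gcongr
        _ ≤ ‖P‖ * (7 / a * (A₀ + A₁ * (a ^ 2 + (σ - s) ^ 2)⁻¹)) := mul_le_mul_of_nonneg_left halg (norm_nonneg _)
        _ = c₇ * m₁ σ := by rw [hm₁σ, hc₇]; ring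
        _ ≤ c₇ * (m₁ σ + m₂ σ) := by nlinarith [hm₂0 σ]
    · -- outer zone
      push Not at hin
      have hpt := norm_derivKernel_mismatch_le (P := P) hq hrpos (norm_nonneg (x σ - L σ)) hδr ht hr.symm le_rfl (htiltθ σ)
      have hD4 : 157 * ‖x σ - L σ‖ / r ^ 4 ≤ 157 * (θ * |σ|) / r ^ 4 := by gcongr; exact hdispθ σ
      have halg := outer_zone_deriv_majorant ha har hLk hLs hθ hin hus
      calc ‖F σ‖ ≤ ‖P‖ * (8 * θ / r ^ 3 + 157 * ‖x σ - L σ‖ / r ^ 4) := hpt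
        _ ≤ ‖P‖ * (8 * θ / r ^ 3 + 157 * (θ * |σ|) / r ^ 4) := by gcongr
        _ ≤ ‖P‖ * (7 / a * (416 * θ * (Lk ^ 2 + (σ - 0) ^ 2)⁻¹)) := mul_le_mul_of_nonneg_left halg (norm_nonneg _)
        _ = c₇ * m₂ σ := by rw [hm₂, hc₇]; ring
        _ ≤ c₇ * (m₁ σ + m₂ σ) := by nlinarith [hm₁0 σ]
  -- integrate
  have hFint : Integrable F := hintA.sub hintB
  have hI : Integrable fun σ => c₇ * (m₁ σ + m₂ σ) := (hI₁.add hI₂).const_mul c₇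
  have hmain : ‖∫ σ, F σ‖ ≤ ∫ σ, c₇ * (m₁ σ + m₂ σ) :=
    norm_integral_le_of_norm_le hI (Eventually.of_forall hmaj)
  have hv₁ : ∫ σ, m₁ σ ≤ 2 * Lk * A₀ + A₁ * (Real.pi / a) := by
    rw [hm₁, MeasureTheory.integral_indicator measurableSet_Icc]
    have hsplit : ∫ σ in Icc (-Lk) Lk, (A₀ + A₁ * (a ^ 2 + (σ - s) ^ 2)⁻¹) =
        (∫ σ in Icc (-Lk) Lk, A₀) + ∫ σ in Icc (-Lk) Lk, A₁ * (a ^ 2 + (σ - s) ^ 2)⁻¹ := by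
      refine integral_add (integrableOn_const (by simp)) ?_
      exact ((continuous_const.mul hψc).integrableOn_Icc)
    rw [hsplit]
    have h1 : ∫ σ in Icc (-Lk) Lk, A₀ = 2 * Lk * A₀ := by
      rw [setIntegral_const, Real.volume_real_Icc_of_le (by linarith), smul_eq_mul]; ring
    have h2 : ∫ σ in Icc (-Lk) Lk, A₁ * (a ^ 2 + (σ - s) ^ 2)⁻¹ ≤ A₁ * (Real.pi / a) := by
      rw [integral_const_mul, ← integral_inv_sq_add_sq ha s]
      refine mul_le_mul_of_nonneg_left ?_ hA₁0
      exact setIntegral_le_integral (integrable_inv_sq_add_sq ha s) (Eventually.of_forall fun σ => by positivity)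
    linarith
  have hv₂ : ∫ σ, m₂ σ = 416 * θ * (Real.pi / Lk) := by
    rw [hm₂, integral_const_mul, integral_inv_sq_add_sq hLk 0]
  have hsum0 : 0 ≤ (∫ σ, m₁ σ) := integral_nonneg hm₁0
  calc ‖∫ σ, F σ‖ ≤ ∫ σ, c₇ * (m₁ σ + m₂ σ) := hmain
    _ = c₇ * ((∫ σ, m₁ σ) + ∫ σ, m₂ σ) := by rw [integral_const_mul, integral_add hI₁ hI₂]
    _ ≤ c₇ * (2 * Lk * A₀ + A₁ * (Real.pi / a) + 416 * θ * (Real.pi / Lk)) := by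
        refine mul_le_mul_of_nonneg_left ?_ hc₇0
        rw [hv₂]; linarith

end Summit.NavierStokesRegularity.NavierStokesRegularity.Theorems.SkeletonJ1RFrame

end
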